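import Literature.Geometry.DiscreteGeometry.HexagonalSpiral
import HarnessLib

/-!
# Harborth's hexagonal spiral of discs: the contact count `9s² + 3s + (3s+2)i + 3j - 1`

Sequel to `HexagonalSpiral.lean` (vocabulary and source quotation there). This file PROVES, chart
by chart, how many already placed discs the next disc of Harborth's spiral touches (`incr r a`:
the previous disc of the ring and one or two discs of the inner hexagon, plus the first disc of the
ring for the last one — Harborth, Elem. Math. 29 (1974) p. 15: "so aufgefüllt, dass jeder neue
Kreis den vorherigen berührt"), and sums these increments:

* `card_nbr_A` … `card_nbr_F`, `card_nbr_eq_incr` — the six charts;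
* `count_config` — `|config r a| = |H_{r-1}| + a`, `adjCount (config r a) = adjCount H_{r-1} +
  2 · ringContacts r a`;
* `count_hexagon` — `|H_s| = 3s² + 3s + 1` with `9s² + 3s` contacts (Heitmann–Radin 1980, (2),
  `j = k = 0`);
* `card_config` — Harborth's count: `3r² - 3r + 1 + a` discs, `9(r-1)² + 3(r-1) + ringContacts r a`
  contacts.

All proofs are linear integer arithmetic after unfolding the charts (`omega`), plus two inductions.
No new definitions. The identification with `[3n - √(12n-3)]` and the discs in `ℝ²` are in
`HarborthConstruction.lean`.
-/

noncomputable section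

namespace Literature.Geometry.DiscreteGeometry

open Finset
open Literature.MathematicalPhysics.StatisticalMechanics

namespace HarborthSpiral
/-! ## The number of placed neighbours of the next ring label, chart by chart

For `p = ringPoint r a` we count the labels of `config r a` adjacent to `p`, using the six
indicators of `card_filter_adj`; every membership is linear arithmetic (`omega`) after unfolding the
charts. The answers (Harborth: each new disc touches the previous one and one or two discs of the
inner hexagon; the last disc of a ring also touches the first): `3 - [a = 0] - [corner]` on charts
A–E, `3` on chart F. -/

/-- Chart A coordinates. [cite: Harborth1974, p. 15] -/
theorem ringPoint_A {r a : ℤ} (h : a ≤ r - 1) : ringPoint r a = (a - r + 1, r) := by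
  simp only [ringPoint, if_pos h]

/-- Chart B coordinates. [cite: Harborth1974, p. 15] -/
theorem ringPoint_B {r a : ℤ} (h1 : ¬ a ≤ r - 1) (h2 : a ≤ 2 * r - 1) :
    ringPoint r a = (a - r + 1, 2 * r - 1 - a) := by
  simp only [ringPoint, if_neg h1, if_pos h2]

/-- Chart C coordinates. [cite: Harborth1974, p. 15] -/
theorem ringPoint_C {r a : ℤ} (h1 : ¬ a ≤ 2 * r - 1) (h2 : a ≤ 3 * r - 1) :
    ringPoint r a = (r, 2 * r - 1 - a) := by
  have hA : ¬ a ≤ r - 1 := fun h => h1 (by omega)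
  simp only [ringPoint, if_neg hA, if_neg h1, if_pos h2]

/-- Chart D coordinates. [cite: Harborth1974, p. 15] -/
theorem ringPoint_D {r a : ℤ} (h1 : ¬ a ≤ 3 * r - 1) (h2 : a ≤ 4 * r - 1) :
    ringPoint r a = (4 * r - 1 - a, -r) := by
  have hA : ¬ a ≤ r - 1 := fun h => h1 (by omega)
  have hB : ¬ a ≤ 2 * r - 1 := fun h => h1 (by omega)
  simp only [ringPoint, if_neg hA, if_neg hB, if_neg h1, if_pos h2]

/-- Chart E coordinates. [cite: Harborth1974, p. 15] -/
theorem ringPoint_E {r a : ℤ} (h1 : ¬ a ≤ 4 * r - 1) (h2 : a ≤ 5 * r - 1) :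
    ringPoint r a = (4 * r - 1 - a, a - 5 * r + 1) := by
  have hA : ¬ a ≤ r - 1 := fun h => h1 (by omega)
  have hB : ¬ a ≤ 2 * r - 1 := fun h => h1 (by omega)
  have hC : ¬ a ≤ 3 * r - 1 := fun h => h1 (by omega)
  simp only [ringPoint, if_neg hA, if_neg hB, if_neg hC, if_neg h1, if_pos h2]

/-- Chart F coordinates. [cite: Harborth1974, p. 15] -/
theorem ringPoint_F {r a : ℤ} (hr : 1 ≤ r) (h1 : ¬ a ≤ 5 * r - 1) :
    ringPoint r a = (-r, a - 5 * r + 1) := by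
  have hA : ¬ a ≤ r - 1 := fun h => h1 (by omega)
  have hB : ¬ a ≤ 2 * r - 1 := fun h => h1 (by omega)
  have hC : ¬ a ≤ 3 * r - 1 := fun h => h1 (by omega)
  have hD : ¬ a ≤ 4 * r - 1 := fun h => h1 (by omega)
  simp only [ringPoint, if_neg hA, if_neg hB, if_neg hC, if_neg hD, if_neg h1]
set_option linter.unusedSimpArgs false in -- one normalisation simp set for all membership checks
/-- Chart A (top row, positions `0 ≤ a ≤ r-1`): the new disc at `(a-r+1, r)` touches the disc below-left always, the previous ring disc iff `a ≥ 1`, and the disc below-right iff it is not the corner (`a ≤ r-2`). [cite: Harborth1974, p. 15] -/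
theorem card_nbr_A {r a : ℕ} (ha : a + 1 ≤ r) :
    ((config r a).filter (Adj (ringPoint r a))).card = (if 1 ≤ a then 1 else 0) + 1 + (if a + 2 ≤ r then 1 else 0) := by
  rw [ringPoint_A (r := (r:ℤ)) (a := (a:ℤ)) (by omega), card_filter_adj]
  dsimp only
  have h1 : ind (config r a) ((a : ℤ) - r + 1 + 1, (r : ℤ)) = 0 := if_neg
    (by rw [mem_config]; simp only [Inside, pos, true_and, and_true]; split_ifs <;> omega)
  have h2 : ind (config r a) ((a : ℤ) - r + 1 - 1, (r : ℤ)) = if 1 ≤ a then 1 else 0 := by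
    by_cases hc : 1 ≤ a
    · rw [if_pos hc]; exact if_pos
        (by rw [mem_config]; simp only [Inside, pos, true_and, and_true]; split_ifs <;> omega)
    · rw [if_neg hc]; exact if_neg
        (by rw [mem_config]; simp only [Inside, pos, true_and, and_true]; split_ifs <;> omega)
  have h3 : ind (config r a) ((a : ℤ) - r + 1, (r : ℤ) + 1) = 0 := if_neg
    (by rw [mem_config]; simp only [Inside, pos, true_and, and_true]; split_ifs <;> omega)
  have h4 : ind (config r a) ((a : ℤ) - r + 1, (r : ℤ) - 1) = 1 := if_pos
    (by rw [mem_config]; simp only [Inside, pos, true_and, and_true]; split_ifs <;> omega)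
  have h5 : ind (config r a) ((a : ℤ) - r + 1 + 1, (r : ℤ) - 1) = if a + 2 ≤ r then 1 else 0 := by
    by_cases hc : a + 2 ≤ r
    · rw [if_pos hc]; exact if_pos
        (by rw [mem_config]; simp only [Inside, pos, true_and, and_true]; split_ifs <;> omega)
    · rw [if_neg hc]; exact if_neg
        (by rw [mem_config]; simp only [Inside, pos, true_and, and_true]; split_ifs <;> omega)
  have h6 : ind (config r a) ((a : ℤ) - r + 1 - 1, (r : ℤ) + 1) = 0 := if_neg
    (by rw [mem_config]; simp only [Inside, pos, true_and, and_true]; split_ifs <;> omega)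
  rw [h1, h2, h3, h4, h5, h6]
  all_goals split_ifs <;> rfl

set_option linter.unusedSimpArgs false in -- one normalisation simp set for all membership checks
/-- Chart B (upper-right side, positions `r ≤ a ≤ 2r-1`): the new disc at `(a-r+1, 2r-1-a)` touches the previous ring disc and one inner disc always, and a second inner disc iff it is not the corner (`a ≤ 2r-2`). [cite: Harborth1974, p. 15] -/
theorem card_nbr_B {r a : ℕ} (ha1 : r ≤ a) (ha : a + 1 ≤ 2 * r) :
    ((config r a).filter (Adj (ringPoint r a))).card = 2 + (if a + 2 ≤ 2 * r then 1 else 0) := by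
  rw [ringPoint_B (r := (r:ℤ)) (a := (a:ℤ)) (by omega) (by omega), card_filter_adj]
  dsimp only
  have h1 : ind (config r a) ((a : ℤ) - r + 1 + 1, 2 * (r : ℤ) - 1 - a) = 0 := if_neg
    (by rw [mem_config]; simp only [Inside, pos, true_and, and_true]; split_ifs <;> omega)
  have h2 : ind (config r a) ((a : ℤ) - r + 1 - 1, 2 * (r : ℤ) - 1 - a) = 1 := if_pos
    (by rw [mem_config]; simp only [Inside, pos, true_and, and_true]; split_ifs <;> omega)
  have h3 : ind (config r a) ((a : ℤ) - r + 1, 2 * (r : ℤ) - 1 - a + 1) = 0 := if_neg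
    (by rw [mem_config]; simp only [Inside, pos, true_and, and_true]; split_ifs <;> omega)
  have h4 : ind (config r a) ((a : ℤ) - r + 1, 2 * (r : ℤ) - 1 - a - 1) = if a + 2 ≤ 2 * r then 1 else 0 := by
    by_cases hc : a + 2 ≤ 2 * r
    · rw [if_pos hc]; exact if_pos
        (by rw [mem_config]; simp only [Inside, pos, true_and, and_true]; split_ifs <;> omega)
    · rw [if_neg hc]; exact if_neg
        (by rw [mem_config]; simp only [Inside, pos, true_and, and_true]; split_ifs <;> omega)
  have h5 : ind (config r a) ((a : ℤ) - r + 1 + 1, 2 * (r : ℤ) - 1 - a - 1) = 0 := if_neg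
    (by rw [mem_config]; simp only [Inside, pos, true_and, and_true]; split_ifs <;> omega)
  have h6 : ind (config r a) ((a : ℤ) - r + 1 - 1, 2 * (r : ℤ) - 1 - a + 1) = 1 := if_pos
    (by rw [mem_config]; simp only [Inside, pos, true_and, and_true]; split_ifs <;> omega)
  rw [h1, h2, h3, h4, h5, h6]
  all_goals split_ifs <;> rfl

set_option linter.unusedSimpArgs false in -- one normalisation simp set for all membership checks
/-- Chart C (right column, positions `2r ≤ a ≤ 3r-1`): the new disc at `(r, 2r-1-a)` touches the previous ring disc and one inner disc always, and a second inner disc iff it is not the corner (`a ≤ 3r-2`). [cite: Harborth1974, p. 15] -/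
theorem card_nbr_C {r a : ℕ} (ha1 : 2 * r ≤ a) (ha : a + 1 ≤ 3 * r) :
    ((config r a).filter (Adj (ringPoint r a))).card = 2 + (if a + 2 ≤ 3 * r then 1 else 0) := by
  rw [ringPoint_C (r := (r:ℤ)) (a := (a:ℤ)) (by omega) (by omega), card_filter_adj]
  dsimp only
  have h1 : ind (config r a) ((r : ℤ) + 1, 2 * (r : ℤ) - 1 - a) = 0 := if_neg
    (by rw [mem_config]; simp only [Inside, pos, true_and, and_true]; split_ifs <;> omega)
  have h2 : ind (config r a) ((r : ℤ) - 1, 2 * (r : ℤ) - 1 - a) = if a + 2 ≤ 3 * r then 1 else 0 := by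
    by_cases hc : a + 2 ≤ 3 * r
    · rw [if_pos hc]; exact if_pos
        (by rw [mem_config]; simp only [Inside, pos, true_and, and_true]; split_ifs <;> omega)
    · rw [if_neg hc]; exact if_neg
        (by rw [mem_config]; simp only [Inside, pos, true_and, and_true]; split_ifs <;> omega)
  have h3 : ind (config r a) ((r : ℤ), 2 * (r : ℤ) - 1 - a + 1) = 1 := if_pos
    (by rw [mem_config]; simp only [Inside, pos, true_and, and_true]; split_ifs <;> omega)
  have h4 : ind (config r a) ((r : ℤ), 2 * (r : ℤ) - 1 - a - 1) = 0 := if_neg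
    (by rw [mem_config]; simp only [Inside, pos, true_and, and_true]; split_ifs <;> omega)
  have h5 : ind (config r a) ((r : ℤ) + 1, 2 * (r : ℤ) - 1 - a - 1) = 0 := if_neg
    (by rw [mem_config]; simp only [Inside, pos, true_and, and_true]; split_ifs <;> omega)
  have h6 : ind (config r a) ((r : ℤ) - 1, 2 * (r : ℤ) - 1 - a + 1) = 1 := if_pos
    (by rw [mem_config]; simp only [Inside, pos, true_and, and_true]; split_ifs <;> omega)
  rw [h1, h2, h3, h4, h5, h6]
  all_goals split_ifs <;> rfl

set_option linter.unusedSimpArgs false in -- one normalisation simp set for all membership checks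
/-- Chart D (bottom row, positions `3r ≤ a ≤ 4r-1`): the new disc at `(4r-1-a, -r)` touches the previous ring disc and one inner disc always, and a second inner disc iff it is not the corner (`a ≤ 4r-2`). [cite: Harborth1974, p. 15] -/
theorem card_nbr_D {r a : ℕ} (ha1 : 3 * r ≤ a) (ha : a + 1 ≤ 4 * r) :
    ((config r a).filter (Adj (ringPoint r a))).card = 2 + (if a + 2 ≤ 4 * r then 1 else 0) := by
  rw [ringPoint_D (r := (r:ℤ)) (a := (a:ℤ)) (by omega) (by omega), card_filter_adj]
  dsimp only
  have h1 : ind (config r a) (4 * (r : ℤ) - 1 - a + 1, -(r : ℤ)) = 1 := if_pos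
    (by rw [mem_config]; simp only [Inside, pos, true_and, and_true]; split_ifs <;> omega)
  have h2 : ind (config r a) (4 * (r : ℤ) - 1 - a - 1, -(r : ℤ)) = 0 := if_neg
    (by rw [mem_config]; simp only [Inside, pos, true_and, and_true]; split_ifs <;> omega)
  have h3 : ind (config r a) (4 * (r : ℤ) - 1 - a, -(r : ℤ) + 1) = 1 := if_pos
    (by rw [mem_config]; simp only [Inside, pos, true_and, and_true]; split_ifs <;> omega)
  have h4 : ind (config r a) (4 * (r : ℤ) - 1 - a, -(r : ℤ) - 1) = 0 := if_neg
    (by rw [mem_config]; simp only [Inside, pos, true_and, and_true]; split_ifs <;> omega)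
  have h5 : ind (config r a) (4 * (r : ℤ) - 1 - a + 1, -(r : ℤ) - 1) = 0 := if_neg
    (by rw [mem_config]; simp only [Inside, pos, true_and, and_true]; split_ifs <;> omega)
  have h6 : ind (config r a) (4 * (r : ℤ) - 1 - a - 1, -(r : ℤ) + 1) = if a + 2 ≤ 4 * r then 1 else 0 := by
    by_cases hc : a + 2 ≤ 4 * r
    · rw [if_pos hc]; exact if_pos
        (by rw [mem_config]; simp only [Inside, pos, true_and, and_true]; split_ifs <;> omega)
    · rw [if_neg hc]; exact if_neg
        (by rw [mem_config]; simp only [Inside, pos, true_and, and_true]; split_ifs <;> omega)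
  rw [h1, h2, h3, h4, h5, h6]

set_option linter.unusedSimpArgs false in -- one normalisation simp set for all membership checks
/-- Chart E (lower-left side, positions `4r ≤ a ≤ 5r-1`): the new disc at `(4r-1-a, a-5r+1)` touches the previous ring disc and one inner disc always, and a second inner disc iff it is not the corner (`a ≤ 5r-2`). [cite: Harborth1974, p. 15] -/
theorem card_nbr_E {r a : ℕ} (ha1 : 4 * r ≤ a) (ha : a + 1 ≤ 5 * r) :
    ((config r a).filter (Adj (ringPoint r a))).card = 2 + (if a + 2 ≤ 5 * r then 1 else 0) := by
  rw [ringPoint_E (r := (r:ℤ)) (a := (a:ℤ)) (by omega) (by omega), card_filter_adj]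
  dsimp only
  have h1 : ind (config r a) (4 * (r : ℤ) - 1 - a + 1, (a : ℤ) - 5 * r + 1) = 1 := if_pos
    (by rw [mem_config]; simp only [Inside, pos, true_and, and_true]; split_ifs <;> omega)
  have h2 : ind (config r a) (4 * (r : ℤ) - 1 - a - 1, (a : ℤ) - 5 * r + 1) = 0 := if_neg
    (by rw [mem_config]; simp only [Inside, pos, true_and, and_true]; split_ifs <;> omega)
  have h3 : ind (config r a) (4 * (r : ℤ) - 1 - a, (a : ℤ) - 5 * r + 1 + 1) = if a + 2 ≤ 5 * r then 1 else 0 := by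
    by_cases hc : a + 2 ≤ 5 * r
    · rw [if_pos hc]; exact if_pos
        (by rw [mem_config]; simp only [Inside, pos, true_and, and_true]; split_ifs <;> omega)
    · rw [if_neg hc]; exact if_neg
        (by rw [mem_config]; simp only [Inside, pos, true_and, and_true]; split_ifs <;> omega)
  have h4 : ind (config r a) (4 * (r : ℤ) - 1 - a, (a : ℤ) - 5 * r + 1 - 1) = 0 := if_neg
    (by rw [mem_config]; simp only [Inside, pos, true_and, and_true]; split_ifs <;> omega)
  have h5 : ind (config r a) (4 * (r : ℤ) - 1 - a + 1, (a : ℤ) - 5 * r + 1 - 1) = 1 := if_pos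
    (by rw [mem_config]; simp only [Inside, pos, true_and, and_true]; split_ifs <;> omega)
  have h6 : ind (config r a) (4 * (r : ℤ) - 1 - a - 1, (a : ℤ) - 5 * r + 1 + 1) = 0 := if_neg
    (by rw [mem_config]; simp only [Inside, pos, true_and, and_true]; split_ifs <;> omega)
  rw [h1, h2, h3, h4, h5, h6]
  all_goals split_ifs <;> rfl

set_option linter.unusedSimpArgs false in -- one normalisation simp set for all membership checks
/-- Chart F (left column, positions `5r ≤ a ≤ 6r-1`): the new disc at `(-r, a-5r+1)` touches the previous ring disc and two placed discs to its right always; for the last corner `(-r, r)` one of them is the FIRST ring disc `(1-r, r)` (the closing bond of the ring). [cite: Harborth1974, p. 15] -/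
theorem card_nbr_F {r a : ℕ} (ha1 : 5 * r ≤ a) (ha : a + 1 ≤ 6 * r) :
    ((config r a).filter (Adj (ringPoint r a))).card = 3 := by
  rw [ringPoint_F (r := (r:ℤ)) (a := (a:ℤ)) (by omega) (by omega), card_filter_adj]
  dsimp only
  have h1 : ind (config r a) (-(r : ℤ) + 1, (a : ℤ) - 5 * r + 1) = 1 := if_pos
    (by rw [mem_config]; simp only [Inside, pos, true_and, and_true]; split_ifs <;> omega)
  have h2 : ind (config r a) (-(r : ℤ) - 1, (a : ℤ) - 5 * r + 1) = 0 := if_neg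
    (by rw [mem_config]; simp only [Inside, pos, true_and, and_true]; split_ifs <;> omega)
  have h3 : ind (config r a) (-(r : ℤ), (a : ℤ) - 5 * r + 1 + 1) = 0 := if_neg
    (by rw [mem_config]; simp only [Inside, pos, true_and, and_true]; split_ifs <;> omega)
  have h4 : ind (config r a) (-(r : ℤ), (a : ℤ) - 5 * r + 1 - 1) = 1 := if_pos
    (by rw [mem_config]; simp only [Inside, pos, true_and, and_true]; split_ifs <;> omega)
  have h5 : ind (config r a) (-(r : ℤ) + 1, (a : ℤ) - 5 * r + 1 - 1) = 1 := if_pos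
    (by rw [mem_config]; simp only [Inside, pos, true_and, and_true]; split_ifs <;> omega)
  have h6 : ind (config r a) (-(r : ℤ) - 1, (a : ℤ) - 5 * r + 1 + 1) = 0 := if_neg
    (by rw [mem_config]; simp only [Inside, pos, true_and, and_true]; split_ifs <;> omega)
  rw [h1, h2, h3, h4, h5, h6]


/-- `ι c (a+1) = ι c a + [a + 1 = c]`. [folklore] -/
private theorem ι_succ (c a : ℕ) : ι c (a + 1) = ι c a + if a + 1 = c then 1 else 0 := by
  unfold ι
  split_ifs <;> omega

/-- No contacts before the ring is started. [cite: Harborth1974, p. 15] -/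
theorem ringContacts_zero {r : ℕ} (hr : 1 ≤ r) : ringContacts r 0 = 0 := by
  unfold ringContacts ι
  rw [if_neg (by omega), if_neg (by omega), if_neg (by omega), if_neg (by omega), if_neg (by omega),
    if_neg (by omega)]
  simp

/-- A complete ring `r` adds `18r - 6` contacts (`= 18s + 12`, `s = r - 1`). [cite: HeitmannRadin1980, §3 (2)] -/
theorem ringContacts_full {r : ℕ} (hr : 1 ≤ r) : ringContacts r (6 * r) = 18 * r - 6 := by
  unfold ringContacts ι
  rw [if_pos (by omega), if_pos (by omega), if_pos (by omega), if_pos (by omega), if_pos (by omega),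
    if_pos (by omega)]
  push_cast
  ring

/-- The recursion `ringContacts r (a+1) = ringContacts r a + incr r a`. [cite: Harborth1974, p. 15] -/
theorem ringContacts_succ (r a : ℕ) :
    ringContacts r (a + 1) = ringContacts r a + incr r a := by
  unfold ringContacts incr
  rw [ι_succ, ι_succ, ι_succ, ι_succ, ι_succ, ι_succ]
  push_cast
  split_ifs <;> omega

/-- The number of placed neighbours of the next label is `incr r a` (all six charts).
[cite: Harborth1974, p. 15] -/
theorem card_nbr_eq_incr {r a : ℕ} (ha : a < 6 * r) :
    (((config r a).filter (Adj (ringPoint r a))).card : ℤ) = incr r a := by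
  unfold incr
  by_cases hA : a + 1 ≤ r
  · rw [card_nbr_A hA]; push_cast; split_ifs <;> omega
  by_cases hB : a + 1 ≤ 2 * r
  · rw [card_nbr_B (by omega) hB]; push_cast; split_ifs <;> omega
  by_cases hC : a + 1 ≤ 3 * r
  · rw [card_nbr_C (by omega) hC]; push_cast; split_ifs <;> omega
  by_cases hD : a + 1 ≤ 4 * r
  · rw [card_nbr_D (by omega) hD]; push_cast; split_ifs <;> omega
  by_cases hE : a + 1 ≤ 5 * r
  · rw [card_nbr_E (by omega) hE]; push_cast; split_ifs <;> omega
  · rw [card_nbr_F (by omega) (by omega)]; push_cast; split_ifs <;> omega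

/-- `H_0` is a single disc with no contacts. [folklore] -/
private theorem adjCount_hexagon_zero : adjCount (hexagon 0) = 0 ∧ (hexagon 0).card = 1 := by
  rw [hexagon_zero]
  refine ⟨?_, card_singleton _⟩
  rw [adjCount, sum_singleton, card_eq_zero, filter_singleton, if_neg (not_adj_self _)]

/-- **The count along a ring.** For `r ≥ 1` and `a ≤ 6r`: `config r a` has `|H_{r-1}| + a` labels
and `adjCount (config r a) = adjCount H_{r-1} + 2 · ringContacts r a`. [cite: Harborth1974, p. 15] -/
theorem count_config {r : ℕ} (hr : 1 ≤ r) (a : ℕ) (ha : a ≤ 6 * r) :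
    (config r a).card = (hexagon (r - 1)).card + a ∧
      (adjCount (config r a) : ℤ) = adjCount (hexagon (r - 1)) + 2 * ringContacts r a := by
  induction a with
  | zero =>
    rw [config_zero hr, ringContacts_zero hr]
    simp
  | succ a ih =>
    obtain ⟨ih1, ih2⟩ := ih (by omega)
    have ha' : a < 6 * r := by omega
    rw [config_succ hr ha', card_insert_of_notMem (ringPoint_not_mem_config hr ha'),
      adjCount_insert (ringPoint_not_mem_config hr ha'), ih1, ringContacts_succ]
    refine ⟨by ring, ?_⟩
    push_cast
    rw [ih2, card_nbr_eq_incr ha']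
    ring

/-- **The hexagon `H_s` has `3s² + 3s + 1` discs and `9s² + 3s` contacts** (Heitmann–Radin (2),
case `j = k = 0`; here `adjCount` counts ordered pairs, `= 18s² + 6s`). [cite: HeitmannRadin1980, §3 (2)] -/
theorem count_hexagon (t : ℕ) :
    (hexagon t).card = 3 * t ^ 2 + 3 * t + 1 ∧ (adjCount (hexagon t) : ℤ) = 18 * t ^ 2 + 6 * t := by
  induction t with
  | zero => simp [adjCount_hexagon_zero]
  | succ t ih =>
    obtain ⟨ih1, ih2⟩ := ih
    have h := count_config (r := t + 1) (by omega) (6 * (t + 1)) le_rfl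
    rw [config_full (by omega), Nat.add_sub_cancel, ih1, ih2, ringContacts_full (by omega)] at h
    obtain ⟨h1, h2⟩ := h
    refine ⟨by rw [h1]; ring, by rw [h2]; push_cast; ring⟩

/-- **Harborth's count.** For `r ≥ 1`, `a ≤ 6r`: `config r a` has `3r² - 3r + 1 + a` labels and
`9(r-1)² + 3(r-1) + ringContacts r a` contacts (`adjCount` = twice that). [cite: Harborth1974, p. 15] -/
theorem card_config {r a : ℕ} (hr : 1 ≤ r) (ha : a ≤ 6 * r) :
    ((config r a).card : ℤ) = 3 * (r : ℤ) ^ 2 - 3 * r + 1 + a ∧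
      (adjCount (config r a) : ℤ) =
        2 * (9 * ((r : ℤ) - 1) ^ 2 + 3 * ((r : ℤ) - 1) + ringContacts r a) := by
  obtain ⟨h1, h2⟩ := count_config hr a ha
  obtain ⟨h3, h4⟩ := count_hexagon (r - 1)
  have hr' : ((r - 1 : ℕ) : ℤ) = (r : ℤ) - 1 := by push_cast [Nat.cast_sub hr]; ring
  refine ⟨?_, ?_⟩
  · rw [h1, h3]; push_cast; rw [hr']; ring
  · rw [h2, h4, hr']; ring

end HarborthSpiral

end Literature.Geometry.DiscreteGeometry

end
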